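import Summits.ABC.IUTFork.ForkGenuineWindow
import Summits.ABC.IUTFork.LDHSlotResidue
import Summits.ABC.IUTFork.LDHExplicitDeltaSplit
import Literature.IUT.LogVolume.TensorPacketContentSharp
import HarnessLib

/-!
# The fork at [IUTchIII] Corollary 3.12 at a GENUINE input: the SHARP lower window for `−|log(Θ)|` — the
# packets' differents against the factor fields' (R2 TARGET #1 «Rest_lower»; Dupuy–Hilado §4.12, [IUTchIV] §1)

Record-only PROOF file (D-0012) of the abc-iut cell (seat abc-iut-w6-d018, part 3 of «Rest_lower»); TAKES NO SIDE.
Sequel to abc-iut-skel/w5-d082's `ForkGenuineWindow` (p-landed: `lowerWindow_le_negLogThetaNonarch`,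
`negLogThetaNonarch_le_upperWindow`, band width `D(I) = Σ_p (1/ℓ⋇) Σ_j Σ_{v⃗} {d_I + 1 + 4|I*|/p}·log p·Π Pr` —
"exactly the log-different term"), to abc-iut-S8's `LDHSlotResidue` (`HullEstimateOf I δ → slotResidue ≤ δ`) and to
the packet-level `TensorPacketContentSharp.packetLogμ_packetHull_orbit_ge_sharp` (parts 1–2: for a bounded region
`M ⊇ ι_a(g)·(R_I)^∼`, `log‖g‖ + (d_I − d_{L_J})·log p ≤ log μ̄(hull(⋃_γ γ·M))` at EVERY factor field `L_J` of
`⊗_{ℚ_p} K_{v̲_b} ≅ ∏_J L_J`). HERE that bound is read at the slot-unions of a genuine Θ-volume input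
`I : ThetaVolumeInput F₀ K` and summed with Dupuy–Hilado's weights (Def. 3.6.3), exactly as `ForkGenuineWindow` does
for w5-d082's `log‖g‖ + δ_Λ`:

* `neg_theta_add_dSharp_le_logμ` — per summand `v⃗ ∈ V(F₀)_p^{j+1}`, every slot `a`, every factor `J`:
  `−θ_j(v_a) + (d_I(v⃗) − d_{L_J}(v⃗))·log p ≤ log μ̄_{v⃗}(Θ-hull)` (`θ_j(v) = P_{Θ,j}(v)·ln|κ(v)|/n_v`);
* **`neg_ndegLgpSlotMin_add_dSharp_le_negLogThetaNonarch`** — the GLOBAL form: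
  `−ndegLgpSlotMin(P_Θ; T(I)) + D♯(I) ≤ negLogThetaNonarch I`, with the SHARP DIFFERENT GAIN
  `D♯(I) := Σ_{p∈T(I)} (1/ℓ⋇)·Σ_j Σ_{v⃗} (d_I(v⃗) − min_J d_{L_J}(v⃗))·log p·Π_b Pr(v_b)` (spelled inline; no definition);
* **`slotResidue_add_dSharp_le_of_hullEstimateOf`** — hence `HullEstimateOf I δ → slotResidue(T(I)) + D♯(I) ≤ δ`:
  every hull-volume estimate of the [IUTchIV] Steps (v)–(viii) shape pays the (Ind1) slot residue (S8) AND the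
  different gain; `slotResidue_add_dSharp_le_explicitDelta` — in particular c312-d1's `explicitDelta I` dominates both;
* `hullEstimateOf_of_slotResidue_add_rest_le` / **`hullEstimateOf_window`** — the TWO-SIDED arithmetic window:
  `slotResidue + explicitDeltaRest ≤ δ ⟹ HullEstimateOf I δ ⟹ slotResidue + D♯ ≤ δ` (sufficient side =
  abc-iut-c312-d1/S8's `hullEstimateOf_slotResidue_add_rest`); band width `explicitDeltaRest − D♯` =
  `Σ ({min_J d_{L_J} + 1}·log p + Σ_{e_a>p−2}{3 + log e_a})·Π Pr/ℓ⋇`;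
* `PointDict.slotResidue_add_dSharp_le_of_hullVolumeAtDatum` — at the `λ`-line: `Cor22.HullVolumeAtDatum P l δ`
  (the `hvol`/`stub_hullRegimeAbove` conclusion of stmt-ABC-19678's skeleton, with `δ = B(P,l)`) forces
  `slotResidue(T) + D♯(T) ≤ δ` at EVERY genuine datum `T` of `(P, l)`.

READING (numbers, not a side): against `ForkGenuineWindow`'s upper end the undecided band per summand is now
`{min_J d_{L_J} + 1 + 4|I*|/p}·log p + δ_Λ` instead of `{d_I + 1 + 4|I*|/p}·log p`: of the different budget
`d_I(v⃗) = Σ_b d_{v_b}` that [IUTchIV] Step (v) ALLOCATES (Prop. 1.2 (ii)), the part `d_I − min_J d_{L_J}` is REALISED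
by the genuine volume. When the `j+1` completions `K_{v̲_b}` are one Galois field (`L_J ≅ K_{v̲}`, `d_{L_J} = d_v`) that
is `j·d_v` of `(j+1)·d_v`, i.e. after the procession average the fraction `(ℓ⋇+1)/(ℓ⋇+3)` of the budget; so on the
UNION line `(ii′-U)` the criterion at a datum is `slotResidue(T) ≤ B(P,l) − D♯(T)` (residue against the SLACK), not
`slotResidue(T) ≤ B(P,l)` (abc-iut-w6-d018 g2's sizing note, HOME/staging/w6/w6-d018/SIZING-R2-TARGET1-…md).
`d_{L_J}` is left as a term. (Ind1)/(Ind2)/hull/possible images are the tree's typings of the disputed corpus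
[claim: Mochizuki2012, status: disputed]; the volume algebra is classical. Nothing here asserts `Cor312Of` or
`HullEstimateOf` for any input; no side taken on [IUTchIII] Cor. 3.12; typed ≠ proved. PROOF-ONLY file.
[cite: DupuyHilado2025, Def. 3.6.3, §4.9, §4.12] [cite: Mochizuki2012, IUTchIV Prop. 1.1 p. 9, Prop. 1.2 (ii) p. 10]
[cite: Mochizuki2012, IUTchIV Thm. 1.10 Steps (iv)–(viii) p. 26–30]
-/

noncomputable section

open Set Literature.IUT.LogVolume NumberField IsDedekindDomain
open scoped Pointwise

namespace Summit.ABC.IUTFork.GenuineContent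

section Window

variable {F₀ : Type} [Field F₀] [NumberField F₀] {K : Type} [Field K] [NumberField K] [Algebra F₀ K]
variable (I : ThetaVolumeInput F₀ K)

/-! ## 1. Per summand: the sharp lower end in θ-currency -/

/-- **Sharp lower end per summand, EVERY slot and EVERY factor field**:
`−θ_j(v_a) + (d_I(v⃗) − d_{L_J}(v⃗))·log p ≤ log μ̄_{v⃗}(Θ-hull)` (the bare Θ-region of slot `a` lies in the slot-union,
which is bounded; `TensorPacketContentSharp.packetLogμ_packetHull_orbit_ge_sharp`).
[cite: DupuyHilado2025, §4.9, §4.12] [cite: Mochizuki2012, IUTchIV Prop. 1.1 p. 9] -/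
theorem neg_theta_add_dSharp_le_logμ {p : ℕ} [hp : Fact p.Prime] (i : Fin I.X.lstar)
    (e : Fin ((i : ℕ) + 1 + 1) → placesOver F₀ p) (a : Fin ((i : ℕ) + 1 + 1))
    (J : DIdx p (fun b => (I.σ.localFieldFamily p hp.out).k (e b))) :
    -(I.X.thetaPilot i (e a).1 * logNorm F₀ (e a).1 / localDegree F₀ (e a).1)
        + (dSum p (fun b => (I.σ.localFieldFamily p hp.out).k (e b))
            - differentOrd p (DFac p (fun b => (I.σ.localFieldFamily p hp.out).k (e b)) J)) * Real.log p ≤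
      (realPrimePacketM p (I.σ.localFieldFamily p hp.out)).logμ
        ((realPrimePacketM p (I.σ.localFieldFamily p hp.out)).possibleImagesHull
          ((realPrimePacketM p (I.σ.localFieldFamily p hp.out)).pilotRegion (I.tΘ p hp.out))
            ((i : ℕ) + 1) e) := by
  have hw := packetLogμ_packetHull_orbit_ge_sharp p (fun b => (I.σ.localFieldFamily p hp.out).k (e b))
    (isPsiBounded_slotUnion (I.σ.localFieldFamily p hp.out) (I.tΘ p hp.out) i e) (I.tΘ p hp.out i (e a)).ne_zero
    (Set.subset_iUnion (fun a : Fin ((i : ℕ) + 1 + 1) =>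
      iota p (fun b => (I.σ.localFieldFamily p hp.out).k (e b)) a
        (I.tΘ p hp.out i (e a) : (I.σ.localFieldFamily p hp.out).k (e a)) •
        (normalizedPacket p (fun b => (I.σ.localFieldFamily p hp.out).k (e b)) :
          Set (PacketAlgebra p (fun b => (I.σ.localFieldFamily p hp.out).k (e b))))) a) J
  have heq : (realPrimePacketM p (I.σ.localFieldFamily p hp.out)).possibleImagesHull
        ((realPrimePacketM p (I.σ.localFieldFamily p hp.out)).pilotRegion (I.tΘ p hp.out)) ((i : ℕ) + 1) e =
      packetHull p (fun b => (I.σ.localFieldFamily p hp.out).k (e b))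
        (⋃ γ : indTwo p (fun b => (I.σ.localFieldFamily p hp.out).k (e b)),
          γ • ⋃ a : Fin ((i : ℕ) + 1 + 1), iota p (fun b => (I.σ.localFieldFamily p hp.out).k (e b)) a
            (I.tΘ p hp.out i (e a) : (I.σ.localFieldFamily p hp.out).k (e a)) •
            (normalizedPacket p (fun b => (I.σ.localFieldFamily p hp.out).k (e b)) :
              Set (PacketAlgebra p (fun b => (I.σ.localFieldFamily p hp.out).k (e b))))) :=
    possibleImagesHull_pilotRegion_eq (I.σ.localFieldFamily p hp.out) (mScale p _) (mScale_ne_zero p _)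
      (mScale_perm p _) (I.tΘ p hp.out) i e
  show _ ≤ packetLogμ p (fun b => (I.σ.localFieldFamily p hp.out).k (e b))
    ((realPrimePacketM p (I.σ.localFieldFamily p hp.out)).possibleImagesHull
      ((realPrimePacketM p (I.σ.localFieldFamily p hp.out)).pilotRegion (I.tΘ p hp.out)) ((i : ℕ) + 1) e)
  rw [heq, ← log_norm_tΘ I i (e a)]
  exact hw

/-- **Sharp lower end per summand, least slot and least factor different**:
`−min_a θ_j(v_a) + (d_I(v⃗) − min_J d_{L_J}(v⃗))·log p ≤ log μ̄_{v⃗}(Θ-hull)`.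
[cite: DupuyHilado2025, §4.9, §4.12] [cite: Mochizuki2012, IUTchIV Prop. 1.1 p. 9] -/
theorem neg_thetaMin_add_dSharp_le_logμ {p : ℕ} [hp : Fact p.Prime] (i : Fin I.X.lstar)
    (e : Fin ((i : ℕ) + 1 + 1) → placesOver F₀ p) :
    -(Finset.univ.inf' ⟨0, Finset.mem_univ _⟩ (fun a =>
          I.X.thetaPilot i (e a).1 * logNorm F₀ (e a).1 / localDegree F₀ (e a).1))
        + (dSum p (fun b => (I.σ.localFieldFamily p hp.out).k (e b))
            - (Finset.univ : Finset (DIdx p (fun b => (I.σ.localFieldFamily p hp.out).k (e b)))).inf'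
                Finset.univ_nonempty
                (fun J => differentOrd p (DFac p (fun b => (I.σ.localFieldFamily p hp.out).k (e b)) J)))
          * Real.log p ≤
      (realPrimePacketM p (I.σ.localFieldFamily p hp.out)).logμ
        ((realPrimePacketM p (I.σ.localFieldFamily p hp.out)).possibleImagesHull
          ((realPrimePacketM p (I.σ.localFieldFamily p hp.out)).pilotRegion (I.tΘ p hp.out))
            ((i : ℕ) + 1) e) := by
  obtain ⟨a₀, -, ha₀⟩ := Finset.exists_mem_eq_inf' (⟨0, Finset.mem_univ _⟩ : (Finset.univ :
    Finset (Fin ((i : ℕ) + 1 + 1))).Nonempty)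
    (fun a => I.X.thetaPilot i (e a).1 * logNorm F₀ (e a).1 / localDegree F₀ (e a).1)
  obtain ⟨J₀, -, hJ₀⟩ := Finset.exists_mem_eq_inf' (Finset.univ_nonempty : (Finset.univ :
    Finset (DIdx p (fun b => (I.σ.localFieldFamily p hp.out).k (e b)))).Nonempty)
    (fun J => differentOrd p (DFac p (fun b => (I.σ.localFieldFamily p hp.out).k (e b)) J))
  rw [ha₀, hJ₀]
  exact neg_theta_add_dSharp_le_logμ I i e a₀ J₀

/-! ## 2. The GLOBAL sharp lower window -/

/-- **GLOBAL SHARP LOWER END**: `−ndegLgpSlotMin(P_Θ; T(I)) + D♯(I) ≤ negLogThetaNonarch I` with the sharp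
different gain `D♯(I) := Σ_{p∈T(I)} (1/ℓ⋇)·Σ_j Σ_{v⃗} (d_I(v⃗) − min_J d_{L_J}(v⃗))·log p·Π_b Pr(v_b)` (spelled
inline) — the free inequality sharpened by the (Ind1)-slot term (abc-iut-S8's `ndegLgpSlotMin`) AND the packets'
differents against their least factor's. Unconditional. [cite: DupuyHilado2025, Def. 3.6.3, §4.12]
[cite: Mochizuki2012, IUTchIV Prop. 1.1 p. 9] -/
theorem neg_ndegLgpSlotMin_add_dSharp_le_negLogThetaNonarch :
    -I.X.ndegLgpSlotMin I.supportPrimes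
        + ∑ p ∈ I.supportPrimes, (1 / (I.X.lstar : ℝ)) * ∑ i : Fin I.X.lstar,
            ∑ e : Fin ((i : ℕ) + 1 + 1) → placesOver F₀ p,
              (if hp : p.Prime then
                haveI : Fact p.Prime := ⟨hp⟩
                (dSum p (fun b => (I.σ.localFieldFamily p hp).k (e b))
                  - (Finset.univ : Finset (DIdx p (fun b => (I.σ.localFieldFamily p hp).k (e b)))).inf'
                      Finset.univ_nonempty
                      (fun J => differentOrd p (DFac p (fun b => (I.σ.localFieldFamily p hp).k (e b)) J)))
                  * Real.log p
               else 0) * ∏ b, weight F₀ (e b).1 ≤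
      I.negLogThetaNonarch := by
  unfold ThetaVolumeInput.negLogThetaNonarch PilotData.ndegLgpSlotMin
  rw [← Finset.sum_neg_distrib, ← Finset.sum_add_distrib]
  refine Finset.sum_le_sum fun p hpT => ?_
  have hp' : p.Prime := I.prime_of_mem_supportPrimes hpT
  haveI hp : Fact p.Prime := ⟨hp'⟩
  simp only [dif_pos hp']
  rw [negLogThetaLoc_eq_sum, ← mul_neg, ← mul_add, ← Finset.sum_neg_distrib, ← Finset.sum_add_distrib]
  refine mul_le_mul_of_nonneg_left (Finset.sum_le_sum fun i _ => ?_) (one_div_lstar_nonneg I)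
  rw [← Finset.sum_neg_distrib, ← Finset.sum_add_distrib]
  refine Finset.sum_le_sum fun e _ => ?_
  rw [← neg_mul, ← add_mul]
  refine mul_le_mul_of_nonneg_right ?_ (prod_weight_nonneg e)
  exact neg_thetaMin_add_dSharp_le_logμ I i e

/-- **Every hull-volume estimate pays the slot residue AND the different gain**:
`HullEstimateOf I δ → slotResidue(P_Θ; T(I)) + D♯(I) ≤ δ` (abc-iut-S8's `slotResidue_le_of_hullEstimateOf`
sharpened by `D♯(I)`; `slotResidue = deĝ̲_lgp(P_Θ) − ndegLgpSlotMin` by Dupuy–Hilado Thm. 3.10.1).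
[cite: DupuyHilado2025, Thm. 3.10.1, §4.12] [cite: Mochizuki2012, IUTchIV Thm. 1.10 Steps (v)–(viii) p. 27–30] -/
theorem slotResidue_add_dSharp_le_of_hullEstimateOf {δ : ℝ} (h : I.HullEstimateOf δ) :
    I.X.slotResidue I.supportPrimes
        + ∑ p ∈ I.supportPrimes, (1 / (I.X.lstar : ℝ)) * ∑ i : Fin I.X.lstar,
            ∑ e : Fin ((i : ℕ) + 1 + 1) → placesOver F₀ p,
              (if hp : p.Prime then
                haveI : Fact p.Prime := ⟨hp⟩
                (dSum p (fun b => (I.σ.localFieldFamily p hp).k (e b))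
                  - (Finset.univ : Finset (DIdx p (fun b => (I.σ.localFieldFamily p hp).k (e b)))).inf'
                      Finset.univ_nonempty
                      (fun J => differentOrd p (DFac p (fun b => (I.σ.localFieldFamily p hp).k (e b)) J)))
                  * Real.log p
               else 0) * ∏ b, weight F₀ (e b).1 ≤ δ := by
  have hl := neg_ndegLgpSlotMin_add_dSharp_le_negLogThetaNonarch I
  have hs : I.X.slotResidue I.supportPrimes =
      LgpDivisor.ndegLgp I.X.thetaPilot - I.X.ndegLgpSlotMin I.supportPrimes := (DHData.ofInput I).slotResidue_eq
  unfold ThetaVolumeInput.HullEstimateOf at h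
  rw [hs]
  linarith

/-- **abc-iut-c312-d1's explicit constant dominates residue plus gain**: `slotResidue(T(I)) + D♯(I) ≤ explicitDelta I`
for every genuine input (its `{d_I + …}` term is used at the rate `d_I − min_J d_{L_J}` by the genuine volume).
[cite: Mochizuki2012, IUTchIV Thm. 1.10 Step (v) p. 27–28] -/
theorem slotResidue_add_dSharp_le_explicitDelta :
    I.X.slotResidue I.supportPrimes
        + ∑ p ∈ I.supportPrimes, (1 / (I.X.lstar : ℝ)) * ∑ i : Fin I.X.lstar,
            ∑ e : Fin ((i : ℕ) + 1 + 1) → placesOver F₀ p,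
              (if hp : p.Prime then
                haveI : Fact p.Prime := ⟨hp⟩
                (dSum p (fun b => (I.σ.localFieldFamily p hp).k (e b))
                  - (Finset.univ : Finset (DIdx p (fun b => (I.σ.localFieldFamily p hp).k (e b)))).inf'
                      Finset.univ_nonempty
                      (fun J => differentOrd p (DFac p (fun b => (I.σ.localFieldFamily p hp).k (e b)) J)))
                  * Real.log p
               else 0) * ∏ b, weight F₀ (e b).1 ≤ DHData.explicitDelta I :=
  slotResidue_add_dSharp_le_of_hullEstimateOf I (DHData.hullEstimateOf_ofInput I)

/-! ## 3. The TWO-SIDED arithmetic window for `HullEstimateOf I δ` -/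

/-- **Sufficient side (abc-iut-c312-d1/S8)**: `slotResidue(T(I)) + explicitDeltaRest I ≤ δ → HullEstimateOf I δ`
(c312-d1's computable half `hullEstimateOf_slotResidue_add_rest`, monotone in `δ`).
[cite: Mochizuki2012, IUTchIV Thm. 1.10 Steps (iv)–(viii) p. 26–30] -/
theorem hullEstimateOf_of_slotResidue_add_rest_le {δ : ℝ}
    (h : I.X.slotResidue I.supportPrimes + DHData.explicitDeltaRest I ≤ δ) : I.HullEstimateOf δ := by
  have h0 := DHData.hullEstimateOf_slotResidue_add_rest I
  unfold ThetaVolumeInput.HullEstimateOf at h0 ⊢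
  linarith

/-- **THE TWO-SIDED WINDOW.** For every genuine input `I` and every `δ`:
`slotResidue + explicitDeltaRest ≤ δ ⟹ HullEstimateOf I δ ⟹ slotResidue + D♯ ≤ δ`, where
`explicitDeltaRest I = Σ_p (1/ℓ⋇) Σ_j Σ_{v⃗} ({d_I + 1}·log p + Σ_{a:e_a>p−2}{3 + log e_a})·Π Pr` (c312-d1/S8) and
`D♯(I) = Σ_p (1/ℓ⋇) Σ_j Σ_{v⃗} (d_I − min_J d_{L_J})·log p·Π Pr`: the hull-volume estimate at `δ` is decided by the
ARITHMETIC of the pilot divisors and differents except inside a band of width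
`explicitDeltaRest − D♯ = Σ_p (1/ℓ⋇) Σ_j Σ_{v⃗} ({min_J d_{L_J} + 1}·log p + Σ_{a:e_a>p−2}{3 + log e_a})·Π Pr` — one
factor field's different per collection plus the tame/wild constants, no longer the whole `d_I`. Pure packaging of
the two sides; nothing asserted about any particular input. [cite: Mochizuki2012, IUTchIV Thm. 1.10 Step (v) p. 27–28]
[cite: DupuyHilado2025, §4.12] -/
theorem hullEstimateOf_window (δ : ℝ) :
    (I.X.slotResidue I.supportPrimes + DHData.explicitDeltaRest I ≤ δ → I.HullEstimateOf δ) ∧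
    (I.HullEstimateOf δ →
      I.X.slotResidue I.supportPrimes
        + ∑ p ∈ I.supportPrimes, (1 / (I.X.lstar : ℝ)) * ∑ i : Fin I.X.lstar,
            ∑ e : Fin ((i : ℕ) + 1 + 1) → placesOver F₀ p,
              (if hp : p.Prime then
                haveI : Fact p.Prime := ⟨hp⟩
                (dSum p (fun b => (I.σ.localFieldFamily p hp).k (e b))
                  - (Finset.univ : Finset (DIdx p (fun b => (I.σ.localFieldFamily p hp).k (e b)))).inf'
                      Finset.univ_nonempty
                      (fun J => differentOrd p (DFac p (fun b => (I.σ.localFieldFamily p hp).k (e b)) J)))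
                  * Real.log p
               else 0) * ∏ b, weight F₀ (e b).1 ≤ δ) :=
  ⟨hullEstimateOf_of_slotResidue_add_rest_le I, slotResidue_add_dSharp_le_of_hullEstimateOf I⟩

end Window

end Summit.ABC.IUTFork.GenuineContent

/-! ## 3. At the `λ`-line: what `HullVolumeAtDatum P l δ` asserts, residue AND different gain made visible -/

namespace Summit.ABC.IUTFork.PointDict

open Literature.NumberTheory.DiophantineGeometry.GenEll

variable {P : NFPoint} {l : ℕ}

/-- **`Cor22.HullVolumeAtDatum P l δ` forces `slotResidue(T) + D♯(T) ≤ δ` at EVERY genuine datum `T` of `(P, l)`**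
(the `hvol` binder of `Conditional/AbcOfS*` and the `stub_hullRegimeAbove` conclusion of stmt-ABC-19678's skeleton
carry `δ = B(P,l)`, the printed bound of [IUTchIV] Thm. 1.10): the union-line estimate is an inequality of the
residue against the SLACK `B(P,l) − D♯(T)`. Nothing asserted about the existence of data.
[claim: Mochizuki2012, status: disputed] -/
theorem slotResidue_add_dSharp_le_of_hullVolumeAtDatum {δ : ℝ} (h : Cor22.HullVolumeAtDatum P l δ)
    (T : Cor22.ThetaVolumeDatumAt P l) :
    (letI := T.instFieldF; letI := T.instNumberFieldF; letI := T.instFieldK; letI := T.instNumberFieldK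
     letI := T.instAlgebraK; letI := T.instIsElliptic
     T.I.X.slotResidue T.I.supportPrimes
        + ∑ p ∈ T.I.supportPrimes, (1 / (T.I.X.lstar : ℝ)) * ∑ i : Fin T.I.X.lstar,
            ∑ e : Fin ((i : ℕ) + 1 + 1) → placesOver (Literature.IUT.HodgeTheaters.fieldOfModuli T.E) p,
              (if hp : p.Prime then
                haveI : Fact p.Prime := ⟨hp⟩
                (dSum p (fun b => (T.I.σ.localFieldFamily p hp).k (e b))
                  - (Finset.univ : Finset (DIdx p (fun b => (T.I.σ.localFieldFamily p hp).k (e b)))).inf'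
                      Finset.univ_nonempty
                      (fun J => differentOrd p (DFac p (fun b => (T.I.σ.localFieldFamily p hp).k (e b)) J)))
                  * Real.log p
               else 0) * ∏ b, weight (Literature.IUT.HodgeTheaters.fieldOfModuli T.E) (e b).1) ≤ δ := by
  letI := T.instFieldF; letI := T.instNumberFieldF; letI := T.instFieldK; letI := T.instNumberFieldK
  letI := T.instAlgebraK; letI := T.instIsElliptic
  exact GenuineContent.slotResidue_add_dSharp_le_of_hullEstimateOf T.I (h T)

end Summit.ABC.IUTFork.PointDict

end
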